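import Summits.BirchSwinnertonDyer.BirchSwinnertonDyer.Theorems.ClassRecordThreeCornerAtThreeShimuraSwapFamilyPrime
import HarnessLib

/-!
# PORT-SPEC (P1), file 3: Kolyvagin's PRIME SWAP for a GENERALISED Kolyvagin datum, brick 2b — the `λ₀` half
# `p^{u+1} ∤ P_{n''}`, `n'' = nℓ'/ℓ₀` (McCallum Prop. 4.4 twice around the EXCLUSION LEMMA) — family twin of bsd-jet pv-2's
# `Swap.not_dvd_of_swap[_kolyvagin]` and of this seat's `Swap.not_dvd_of_swap_kolyvagin_of_irreducible`
# (cell `bsd-stepL`, seat `bsd-stepL-corner-p1` g15; `--supports stmt-BirchSwinnertonDyer-21420 --as helper`)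

WHY/WHAT. See file 2 (`…ShimuraSwapFamilyPrime`, brick 2a: the `λ'` half, whose outputs `ℓ', λ', λ₀, t, loc_{λ'} c_{1+u}(n) ≠ 0`
are inputs here). THIS FILE = brick 2b for THREE family data `d` (conductor `n`), `d'` (`nℓ'`), `d''` (`nℓ'/ℓ₀`): McCallum
Prop. 4.4 at `λ'` (`h44up`, the ORDER EQUALITY of the localised classes of `d'` and `d`) moves the non-vanishing to
`c_{1+u}(P_{nℓ'})`; its root class `y` (exact depth `u` by `hdvd'` and `c_{1+u} ≠ 0`; sign `−e₀` transported down the injective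
`ι_*` (`hbot`); Selmer membership `hsel'` of the root classes of `d'`) is NOT Kummer at `λ'` (`Kum ∩ 𝒯 = 0`, `hdisj`); bsd-jet's
EXCLUSION LEMMA (`Swap.localization_eq_zero_of_strict_of_relaxed`, curve-side, reused verbatim) with the auxiliary class `t`
forbids `loc_{λ₀} y = 0`; Prop. 4.4 at `λ₀` (`h44dn`, the order equality for `d'` and `d''`) gives `c_{1+u}(P_{n''}) ≠ 0`, i.e.
`p^{u+1} ∤ P_{n''}` (McCallum p. 306). Versus the `X₀(N)` bricks: McCallum 4.4 (there the typed fact `h44` ∕ Gross 3.7 (2) BY NAME),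
the Gross 5.4 sign, [GZ86 III (3.1)] + McCallum 4.3 (Selmer membership of the root class) and Gross 4.3 ∕ 3.6 (standing inputs)
are DISPLAYED HYPOTHESES on the three data — for the labelled CM family of `X_{N⁺,N⁻}` they are the labels (B3)–(B6) through the
suppliers of lanes corner3-p2 ∕ tam3-p1; the standing inputs of `d'`, `d''` are READ OFF the non-vanishing of their classes
(`KolyvaginFamilyData.standingInputs_of_kolyvaginClass_ne_zero`). HONEST FRAMING: one theorem, no definition ∕ fact ∕ sorry;
CONDITIONAL on the displayed inputs; nothing about any curve; no stub ∕ item closes; BSD is not proved by any of this; T7.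
Credit: bsd-jet pv-2 (statement, proof, exclusion lemma), tam3-p1 (supplies, family datum), shim-p1 (torsion leaf).
References (locators only): [cite: McCallumLMS1991, §5 Prop. 5.2 and proof (pp. 304–306), §4 Prop. 4.4, Lemma 4.3]
[cite: Jetchev2008, §3.1 item 7, Lemma 5.2, Thm. 5.1] [cite: GrossZagier1986, III (3.1)] [cite: Howard2004HeegnerKolyvagin, Lemma 2.7.3].
presearch: not applicable (re-keying of tree theorems). Design: no definitions; `K : Type`. Axioms: `propext`, `Classical.choice`, `Quot.sound`.
-/

set_option autoImplicit false

noncomputable section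

open scoped Classical Pointwise
open Function NumberField IsDedekindDomain WeierstrassCurve Field
open Literature.NumberTheory.EllipticCurves Literature.NumberTheory.GaloisRepresentations
open Literature.NumberTheory.EllipticCurves.Jetchev2008 Literature.NumberTheory.EllipticCurves.KolyvaginCocycle
open Literature.NumberTheory.EllipticCurves.ModularForms
open Literature.NumberTheory.GaloisCohomology Literature.NumberTheory.Automorphic
open Literature.NumberTheory.GaloisRepresentations.DiscreteGaloisModule (transverseSubgroup SelmerStructure)
open Summit.BirchSwinnertonDyer.Rank1Residual.JET.SelmerVocabulary
open Summit.BirchSwinnertonDyer.Rank1Residual.JET.GlobalDuality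
open Summit.BirchSwinnertonDyer.Rank1Residual.X11b
open Summit.BirchSwinnertonDyer.Rank1Residual.X11b.Three
open Summit.BirchSwinnertonDyer.BirchSwinnertonDyer.Theorems
open Summit.BirchSwinnertonDyer.BirchSwinnertonDyer.Theorems.ShimuraKolyvaginFixedOfTorsion

namespace Summit.BirchSwinnertonDyer.Rank1Residual.JET.Swap

variable {K : Type} [Field K] [NumberField K] (W : WeierstrassCurve ℚ) [W.IsElliptic]
  [W.IsGloballyMinimal]

section Prime

variable (τ : K ≃ₐ[ℚ] K) (p : ℕ) [Fact p.Prime] [NeZero (p ^ 1)]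
  [Finite (geomTorsion (W.baseChange K) ((p ^ 1 : ℕ) : ℤ))]
  (e : geomTorsion (W.baseChange K) ((p ^ 1 : ℕ) : ℤ) → geomTorsion (W.baseChange K) ((p ^ 1 : ℕ) : ℤ) →
    AlgebraicClosure K)
  (hμ : ∀ S T, e S T ^ (p ^ 1) = 1)
  (hadd₁ : ∀ S₁ S₂ T, e (S₁ + S₂) T = e S₁ T * e S₂ T)
  (hadd₂ : ∀ S T₁ T₂, e S (T₁ + T₂) = e S T₁ * e S T₂)
  (hgal : ∀ (g : absoluteGaloisGroup K) (S T : geomTorsion (W.baseChange K) ((p ^ 1 : ℕ) : ℤ)),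
    g • e S T = e (g • S) (g • T))
  (halt : ∀ T, e T T = 1) (hnondeg : ∀ T, (∀ S, e S T = 1) → T = 0)
  (hτe : ∀ S T, liftAut τ (e S T) =
    e ((isLiftOfAut_liftAut τ).torsionMap W ((p ^ 1 : ℕ) : ℤ) S)
      ((isLiftOfAut_liftAut τ).torsionMap W ((p ^ 1 : ℕ) : ℤ) T))

set_option maxHeartbeats 400000 in
include halt hnondeg hτe in
/-- **The `λ₀` half of Kolyvagin's swap for GENERALISED Kolyvagin data: `p^{u+1} ∤ P_{n''}`, `n'' = nℓ'/ℓ₀`** (McCallum, proof of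
Prop. 5.2, p. 306, run at level `p` on the root classes). Data: the frame as in brick 2a (`τ² = 1`, `p` odd, Poitou–Tate package,
Weil datum, transverse family with `h𝒯σ`, `h𝒯sd`, `hloc`, `hdisj`; `E(K)[p] = 0`); a square-free `n` over Kolyvagin primes of index
`≥ 1 + u`, `ℓ₀ ∣ n`, a fresh Kolyvagin prime `ℓ'` of index `≥ 1 + u` with places `λ' ∋ ℓ'`, `λ₀ ∋ ℓ₀`; family data `d`, `d'`, `d''`
at `n`, `nℓ'`, `nℓ'/ℓ₀`; brick 2a's outputs `hxup` (`loc_{λ'} c_{1+u}(n) ≠ 0`) and the auxiliary class `t` of sign `−e₀` relaxed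
at `λ₀` with `loc_{λ'} t ≠ 0`; and on `d'`: `p^u ∣ P_{nℓ'}` (`hdvd'`, minimality), the sign `τ_* c_{1+u}(nℓ') = −e₀ • c_{1+u}(nℓ')`,
the Selmer membership of its level-`p` root classes (`hsel'`), and the two McCallum 4.4 order equalities at `λ'` (`h44up`: `d'`
vs `d`) and at `λ₀` (`h44dn`: `d'` vs `d''`). CONCLUSION: `p^{u+1} ∤ P(d'')`. [cite: McCallumLMS1991, §5 proof of Prop. 5.2 (pp. 305–306),
§4 Prop. 4.4] [cite: Jetchev2008, §3.1 item 7, Lemma 5.2] [cite: GrossZagier1986, III (3.1)] -/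
theorem not_dvd_of_swap_family (hK : IsImaginaryQuadratic K) (hp2 : p ≠ 2) (hττ : τ * τ = 1)
    {ι : K →+* ℂ}
    (inv : LocalInvariants K (p ^ 1)) (hperf : inv.IsPerfect) (hvan : inv.SumLocalTermEqZero)
    (hSC : inv.SelmerComplement) (hinv : inv.IsConjCompatible τ)
    (𝒯 : SelmerStructure ((W.baseChange K).torsionGaloisModule ((p ^ 1 : ℕ) : ℤ)))
    (h𝒯σ : ∀ (c : ℕ), Squarefree c →
      (∀ q ∈ c.primeFactors, Zhang2014.IsKolyvaginPrime (W.conductorNorm ℤ) W K p q) →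
      ∀ (v w : HeightOneSpectrum (𝓞 K)) (h : τ • v = w), v ∈ placesDividing K c →
      ∀ x : galoisCohomology (((W.baseChange K).torsionGaloisModule ((p ^ 1 : ℕ) : ℤ)).toLocal
        (Sum.inr v : Place K)) 1,
      x ∈ 𝒯 (Sum.inr v) → conjActPlace W τ ((p ^ 1 : ℕ) : ℤ) h x ∈ 𝒯 (Sum.inr w))
    (h𝒯sd : ∀ (c : ℕ), Squarefree c →
      (∀ q ∈ c.primeFactors, Zhang2014.IsKolyvaginPrime (W.conductorNorm ℤ) W K p q) →
      ∀ v ∈ placesDividing K c,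
      inv.dualTransported 𝒯 (weilDualIntertwining (W.baseChange K) (p ^ 1) e hμ hadd₁ hadd₂ hgal)
        (Sum.inr v) = 𝒯 (Sum.inr v))
    (hloc : ∀ ℓ : ℕ, Zhang2014.IsKolyvaginPrime (W.conductorNorm ℤ) W K p ℓ →
      1 ≤ Zhang2014.kolyvaginIndex W p ℓ →
      ∀ (v : HeightOneSpectrum (𝓞 K)), (ℓ : 𝓞 K) ∈ v.asIdeal → ∀ (hfix : τ • v = v) (s : ℤ),
      (s = 1 ∨ s = -1) →
      ((W.baseChange K).kummerSelmerStructure ((p ^ 1 : ℕ) : ℤ) (Sum.inr v)).relIndex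
        ((conjActPlace W τ ((p ^ 1 : ℕ) : ℤ) hfix - s • AddMonoidHom.id _).ker) = p ^ 1)
    (hdisj : ∀ ℓ : ℕ, Zhang2014.IsKolyvaginPrime (W.conductorNorm ℤ) W K p ℓ →
      ∀ v : HeightOneSpectrum (𝓞 K), (ℓ : 𝓞 K) ∈ v.asIdeal →
      Disjoint ((W.baseChange K).kummerSelmerStructure ((p ^ 1 : ℕ) : ℤ) (Sum.inr v)) (𝒯 (Sum.inr v)))
    (hbot : AddSubgroup.torsionBy (W.baseChange K).toAffine.Point (p : ℤ) = ⊥)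
    -- the swap data
    {u n l₀ ℓ' : ℕ} (hn : Squarefree n)
    (hnK : ∀ q ∈ n.primeFactors, Zhang2014.IsKolyvaginPrime (W.conductorNorm ℤ) W K p q ∧
      1 + u ≤ Zhang2014.kolyvaginIndex W p q)
    (hl₀ : l₀ ∈ n.primeFactors) (hKol' : Zhang2014.IsKolyvaginPrime (W.conductorNorm ℤ) W K p ℓ')
    (h1u : 1 + u ≤ Zhang2014.kolyvaginIndex W p ℓ') (hℓ'n : ℓ' ∉ n.primeFactors)
    {v' v₀ : HeightOneSpectrum (𝓞 K)} (hv' : (ℓ' : 𝓞 K) ∈ v'.asIdeal) (hv₀ : (l₀ : 𝓞 K) ∈ v₀.asIdeal)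
    (d : KolyvaginFamilyData W K ι n) (d' : KolyvaginFamilyData W K ι (n * ℓ'))
    (d'' : KolyvaginFamilyData W K ι (n / l₀ * ℓ'))
    (hxup : galoisCohomology.localization ((W.baseChange K).torsionGaloisModule ((p ^ (1 + u) : ℕ) : ℤ))
        (Sum.inr v' : Place K) 1 (d.kolyvaginClass (Fact.out : p.Prime) (1 + u)) ≠ 0)
    {e₀ : ℤ} (he₀ : e₀ = 1 ∨ e₀ = -1)
    (t : galoisCohomology ((W.baseChange K).torsionGaloisModule ((p ^ 1 : ℕ) : ℤ)) 1)
    (ht : t ∈ signPart W K τ ((p ^ 1 : ℕ) : ℤ) (-e₀)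
        (((selmerF W ((p ^ 1 : ℕ) : ℤ) 𝒯 (placesDividing K (n / l₀))).relaxedAt {v₀}).selmerGroup))
    (htv' : galoisCohomology.localization ((W.baseChange K).torsionGaloisModule ((p ^ 1 : ℕ) : ℤ))
        (Sum.inr v' : Place K) 1 t ≠ 0)
    -- the inputs on `d'`: minimality, sign, Selmer membership of its root classes
    (hdvd' : ∃ Q : (W.baseChange (ringClassField K ι (n * ℓ'))).toAffine.Point,
      ((p ^ u : ℕ) : ℤ) • Q = d'.derivedPoint)
    (hκ'sign : conjAct W τ ((p ^ (1 + u) : ℕ) : ℤ) (d'.kolyvaginClass (Fact.out : p.Prime) (1 + u)) =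
      (-e₀) • d'.kolyvaginClass (Fact.out : p.Prime) (1 + u))
    (hsel' : ∀ (Q' : (W.baseChange (ringClassField K ι (n * ℓ'))).toAffine.Point)
      (hA1' : IsAdmissible (absoluteGaloisGroup K) d'.pointsSubgroup ((p ^ 1 : ℕ) : ℤ))
      (hQ' : d'.toGeomPoints Q' ∈ invPoints (absoluteGaloisGroup K) d'.pointsSubgroup ((p ^ 1 : ℕ) : ℤ)),
      ((p ^ u : ℕ) : ℤ) • Q' = d'.derivedPoint →
      kolyvaginClass (W.baseChange K) ((p ^ 1 : ℕ) : ℤ)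
          ((W.baseChange K).zsmul_geomPoints_surjective_of_charZero
            (by exact_mod_cast pow_ne_zero 1 (Fact.out : p.Prime).ne_zero)) hA1' (d'.toGeomPoints Q') hQ' ∈
        (selmerF W ((p ^ 1 : ℕ) : ℤ) 𝒯 (placesDividing K (n * ℓ'))).selmerGroup)
    -- McCallum Prop. 4.4 at `λ'` (for `d ≼ d'`) and at `λ₀` (for `d'' ≼ d'`), as ORDER EQUALITIES
    (h44up : addOrderOf ((galoisCohomology.localization
        ((W.baseChange K).torsionGaloisModule ((p ^ (1 + u) : ℕ) : ℤ)) (Sum.inr v') 1 :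
          galH1Torsion (W.baseChange K) ((p ^ (1 + u) : ℕ) : ℤ) →+ _)
        (d'.kolyvaginClass (Fact.out : p.Prime) (1 + u))) =
      addOrderOf ((galoisCohomology.localization
        ((W.baseChange K).torsionGaloisModule ((p ^ (1 + u) : ℕ) : ℤ)) (Sum.inr v') 1 :
          galH1Torsion (W.baseChange K) ((p ^ (1 + u) : ℕ) : ℤ) →+ _)
        (d.kolyvaginClass (Fact.out : p.Prime) (1 + u))))
    (h44dn : addOrderOf ((galoisCohomology.localization
        ((W.baseChange K).torsionGaloisModule ((p ^ (1 + u) : ℕ) : ℤ)) (Sum.inr v₀) 1 :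
          galH1Torsion (W.baseChange K) ((p ^ (1 + u) : ℕ) : ℤ) →+ _)
        (d'.kolyvaginClass (Fact.out : p.Prime) (1 + u))) =
      addOrderOf ((galoisCohomology.localization
        ((W.baseChange K).torsionGaloisModule ((p ^ (1 + u) : ℕ) : ℤ)) (Sum.inr v₀) 1 :
          galH1Torsion (W.baseChange K) ((p ^ (1 + u) : ℕ) : ℤ) →+ _)
        (d''.kolyvaginClass (Fact.out : p.Prime) (1 + u)))) :
    ¬ ∃ Q : (W.baseChange (ringClassField K ι (n / l₀ * ℓ'))).toAffine.Point,
      ((p ^ (u + 1) : ℕ) : ℤ) • Q = d''.derivedPoint := by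
  have hp : p.Prime := Fact.out
  have hn0 : n ≠ 0 := hn.ne_zero
  have hl₀p : l₀.Prime := Nat.prime_of_mem_primeFactors hl₀
  have hl₀n : l₀ ∣ n := Nat.dvd_of_mem_primeFactors hl₀
  have hKol₀ : Zhang2014.IsKolyvaginPrime (W.conductorNorm ℤ) W K p l₀ := (hnK l₀ hl₀).1
  have hℓ'p : ℓ'.Prime := hKol'.1
  have hℓ'0 : ℓ' ≠ 0 := hℓ'p.ne_zero
  have hℓ'dvd : ¬ ℓ' ∣ n := fun h ↦ hℓ'n (Nat.mem_primeFactors.mpr ⟨hℓ'p, h, hn0⟩)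
  have hdn : p ^ 1 ∣ p ^ (1 + u) := pow_dvd_pow p (Nat.le_add_right 1 u)
  have hN : Squarefree (n * ℓ') :=
    (Nat.squarefree_mul ((Nat.Prime.coprime_iff_not_dvd hℓ'p).mpr hℓ'dvd).symm).mpr
      ⟨hn, hℓ'p.squarefree⟩
  have hN0 : n * ℓ' ≠ 0 := hN.ne_zero
  have hNpf : (n * ℓ').primeFactors = n.primeFactors ∪ {ℓ'} := by
    rw [Nat.primeFactors_mul hn0 hℓ'0, hℓ'p.primeFactors]
  -- Prop. 4.4 at `λ'`: `loc_{λ'} c_{1+u}(nℓ') ≠ 0`, hence `c_{1+u}(nℓ') ≠ 0` and its standing inputs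
  have hκ'v' : galoisCohomology.localization ((W.baseChange K).torsionGaloisModule ((p ^ (1 + u) : ℕ) : ℤ))
      (Sum.inr v' : Place K) 1 (d'.kolyvaginClass hp (1 + u)) ≠ 0 := by
    intro h
    have h' := h44up
    rw [show (galoisCohomology.localization ((W.baseChange K).torsionGaloisModule ((p ^ (1 + u) : ℕ) : ℤ))
      (Sum.inr v' : Place K) 1 : galH1Torsion (W.baseChange K) ((p ^ (1 + u) : ℕ) : ℤ) →+ _)
      (d'.kolyvaginClass hp (1 + u)) = 0 from h, addOrderOf_zero] at h'
    exact hxup (AddMonoid.addOrderOf_eq_one_iff.mp h'.symm)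
  have hκ'0 : d'.kolyvaginClass hp (1 + u) ≠ 0 := fun h ↦ hκ'v' (by rw [h]; exact map_zero _)
  obtain ⟨hA', hP'⟩ := d'.standingInputs_of_kolyvaginClass_ne_zero hκ'0
  have hndvd' : ¬ ∃ Q : (W.baseChange (ringClassField K ι (n * ℓ'))).toAffine.Point,
      ((p ^ (u + 1) : ℕ) : ℤ) • Q = d'.derivedPoint :=
    d'.not_pDiv_succ_of_kolyvaginClass_ne_zero hp u hκ'0
  -- the root class `y` of `P_{nℓ'}`: order `p`, sign `−e₀`, in `H_{𝓕(nℓ')}`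
  obtain ⟨hA1', Q', hQ', hQ'P, hord', -⟩ :=
    d'.exists_rootClass_of_exactDepth hp (k := 1) (u := u) le_rfl hA' hP' hdvd' hndvd'
  set y : galH1Torsion (W.baseChange K) ((p ^ 1 : ℕ) : ℤ) :=
    kolyvaginClass (W.baseChange K) ((p ^ 1 : ℕ) : ℤ)
      ((W.baseChange K).zsmul_geomPoints_surjective_of_charZero
        (by exact_mod_cast pow_ne_zero 1 hp.ne_zero)) hA1' (d'.toGeomPoints Q') hQ' with hydef
  have hrooty := d'.torsionH1OfDvd_rootClass_eq hp 1 u hA' Q' hA1' hQ' hQ'P hP'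
  have hysign : conjAct W τ ((p ^ 1 : ℕ) : ℤ) y = (-e₀) • y :=
    conjAct_eq_smul_of_torsionH1OfDvd W τ _ (torsionH1OfDvd_pow_injective_of_torsionBy_eq_bot W hbot 1 u) (-e₀) y
      (by rw [hrooty]; exact hκ'sign)
  have hySel : y ∈ (selmerF W ((p ^ 1 : ℕ) : ℤ) 𝒯 (placesDividing K (n * ℓ'))).selmerGroup :=
    hsel' Q' hA1' hQ' hQ'P
  -- `y` is NOT Kummer at `λ'`
  have htriv' : ∀ (g : absoluteGaloisGroup (v'.adicCompletion K))
      (P : geomTorsion (W.baseChange K) ((p ^ (1 + u) : ℕ) : ℤ)), resGal (K := K) (v'.adicCompletion K) g • P = P :=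
    Walk.resGal_adicCompletion_smul_torsion_eq_self W hK hKol' h1u v' hv'
  have hyv'0 : galoisCohomology.localization ((W.baseChange K).torsionGaloisModule ((p ^ 1 : ℕ) : ℤ))
      (Sum.inr v' : Place K) 1 y ≠ 0 := by
    intro h
    apply hκ'v'
    rw [← hrooty]
    exact (localization_eq_zero_iff_torsionH1OfDvd W hdn (pow_ne_zero 1 hp.ne_zero)
      (pow_ne_zero _ hp.ne_zero) v' htriv' y).mp h
  have hv'N : v' ∈ placesDividing K (n * ℓ') := by
    rw [mem_placesDividing_iff_natCast_mem hN0, Nat.cast_mul]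
    exact v'.asIdeal.mul_mem_left _ hv'
  have hyv' : galoisCohomology.localization ((W.baseChange K).torsionGaloisModule ((p ^ 1 : ℕ) : ℤ))
      (Sum.inr v' : Place K) 1 y ∉
      (W.baseChange K).kummerSelmerStructure ((p ^ 1 : ℕ) : ℤ) (Sum.inr v') := by
    intro hKum
    have hT : galoisCohomology.localization ((W.baseChange K).torsionGaloisModule ((p ^ 1 : ℕ) : ℤ))
        (Sum.inr v' : Place K) 1 y ∈ 𝒯 (Sum.inr v') :=
      ((mem_selmerGroup_selmerF_iff W _ 𝒯 hN0 _).mp hySel).2 v' hv'N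
    exact hyv'0 ((hdisj ℓ' hKol' v' hv').le_bot ⟨hKum, hT⟩)
  -- the conductor `m = n/ℓ₀` and the two places
  have hmn : n / l₀ ∣ n := Nat.div_dvd_of_dvd hl₀n
  have hm : Squarefree (n / l₀) := hn.squarefree_of_dvd hmn
  have hm0 : n / l₀ ≠ 0 := hm.ne_zero
  have hmK : ∀ q ∈ (n / l₀).primeFactors, Zhang2014.IsKolyvaginPrime (W.conductorNorm ℤ) W K p q :=
    fun q hq ↦ (hnK q (Nat.primeFactors_mono hmn hn0 hq)).1
  have hl₀m : l₀ ∉ (n / l₀).primeFactors := by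
    intro h
    have hdvd₂ : l₀ * l₀ ∣ n := by
      have := Nat.mul_dvd_mul_left l₀ (Nat.dvd_of_mem_primeFactors h)
      rwa [Nat.mul_div_cancel' hl₀n] at this
    exact hl₀p.one_lt.ne' (Nat.isUnit_iff.mp (hn l₀ hdvd₂))
  have hℓ'm : ℓ' ∉ (n / l₀).primeFactors := fun h ↦ hℓ'n (Nat.primeFactors_mono hmn hn0 h)
  have hfix₀ : τ • v₀ = v₀ := smul_place_eq_self_of_natCast_mem τ hl₀p.ne_zero hKol₀.2.2.2.2.1 v₀ hv₀
  have hv₀m : v₀ ∉ placesDividing K (n / l₀) := by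
    rw [mem_placesDividing_iff_natCast_mem hm0, natCast_mem_iff_exists_primeFactor_mem hm0]
    rintro ⟨q, hq, hqv⟩
    have := Walk.prime_eq_of_natCast_mem v₀ (Nat.prime_of_mem_primeFactors hq) hl₀p hqv hv₀
    exact hl₀m (this ▸ hq)
  have hv'v₀ : v' ≠ v₀ := by
    rintro rfl
    have := Walk.prime_eq_of_natCast_mem v' hℓ'p hl₀p hv' hv₀
    exact hℓ'n (this ▸ hl₀)
  -- `y` satisfies `𝓕(n/ℓ₀)` off `{λ₀, λ'}`
  have hyF : ∀ w : HeightOneSpectrum (𝓞 K), w ≠ v₀ → w ≠ v' →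
      galoisCohomology.localization ((W.baseChange K).torsionGaloisModule ((p ^ 1 : ℕ) : ℤ))
        (Sum.inr w : Place K) 1 y ∈ selmerF W ((p ^ 1 : ℕ) : ℤ) 𝒯 (placesDividing K (n / l₀)) (Sum.inr w) := by
    intro w hw₀ hw'
    obtain ⟨hKum, hT⟩ := (mem_selmerGroup_selmerF_iff W _ 𝒯 hN0 _).mp hySel
    have hcover : ∀ q ∈ (n * ℓ').primeFactors, (q : 𝓞 K) ∈ w.asIdeal → q ∈ (n / l₀).primeFactors := by
      intro q hq hqw
      rw [hNpf, Finset.mem_union, Finset.mem_singleton] at hq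
      rcases hq with hq | rfl
      · by_contra hqm
        have hqn := Nat.dvd_of_mem_primeFactors hq
        have hql₀ : q = l₀ := by
          by_contra hne
          apply hqm
          refine Nat.mem_primeFactors.mpr ⟨Nat.prime_of_mem_primeFactors hq, ?_, hm0⟩
          have hcop : Nat.Coprime q l₀ :=
            (Nat.coprime_primes (Nat.prime_of_mem_primeFactors hq) hl₀p).mpr hne
          exact (hcop.dvd_mul_right).mp (by rw [Nat.div_mul_cancel hl₀n]; exact hqn)
        subst hql₀
        exact hw₀ (Walk.place_eq_of_natCast_mem_of_isPrime hl₀p.ne_zero hKol₀.2.2.2.2.1 w v₀ hqw hv₀)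
      · exact absurd (Walk.place_eq_of_natCast_mem_of_isPrime hℓ'p.ne_zero hKol'.2.2.2.2.1 w v' hqw hv')
          hw'
    rw [selmerF_inr]
    by_cases hw : w ∈ placesDividing K (n / l₀)
    · rw [if_pos hw]
      refine hT w ?_
      rw [mem_placesDividing_iff_natCast_mem hm0] at hw
      rw [mem_placesDividing_iff_natCast_mem hN0]
      have : (n / l₀ : ℕ) ∣ n * ℓ' := hmn.trans (Dvd.intro ℓ' rfl)
      obtain ⟨c, hc⟩ := this
      rw [hc, Nat.cast_mul]
      exact w.asIdeal.mul_mem_right _ hw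
    · rw [if_neg hw]
      refine hKum (Sum.inr w) fun q hq hP ↦ hw ?_
      obtain ⟨w₁, hw₁, hqw₁⟩ := hP
      cases hw₁
      rw [mem_placesDividing_iff_natCast_mem hm0, natCast_mem_iff_exists_primeFactor_mem hm0]
      exact ⟨q, hcover q hq hqw₁, hqw₁⟩
  -- the EXCLUSION LEMMA: `loc_{λ₀} y ≠ 0`
  have hs : (-e₀ = 1 ∨ -e₀ = -1) := by rcases he₀ with h | h <;> [right; left] <;> omega
  have htsign : conjAct W τ ((p ^ 1 : ℕ) : ℤ) t = (-e₀) • t := ((mem_signPart_iff W K τ _ _ _ t).mp ht).2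
  have htF := ((mem_signPart_iff W K τ _ _ _ t).mp ht).1
  have hy₀ : galoisCohomology.localization ((W.baseChange K).torsionGaloisModule ((p ^ 1 : ℕ) : ℤ))
      (Sum.inr v₀ : Place K) 1 y ≠ 0 := by
    intro hy0
    exact htv' (localization_eq_zero_of_strict_of_relaxed W τ p 1 e hμ hadd₁ hadd₂ hgal halt hnondeg hτe
      hττ hp2 le_rfl inv hperf hvan hSC hinv 𝒯 hm0 (h𝒯σ _ hm hmK) (h𝒯sd _ hm hmK) hs hp
      (fun ℓ hℓ hk _ v hv hfix ↦ by rw [hloc ℓ hℓ hk v hv hfix _ hs, pow_one]) hfix₀ hv₀m hKol'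
      (le_trans (by omega) h1u) hℓ'm hv' hv'v₀ y hysign hyF hy0 hyv' t htsign htF)
  -- back up at `λ₀`, then Prop. 4.4 at `λ₀`: `c_{1+u}(n'') ≠ 0`
  have h1u₀ : 1 + u ≤ Zhang2014.kolyvaginIndex W p l₀ := (hnK l₀ hl₀).2
  have htriv₀ : ∀ (g : absoluteGaloisGroup (v₀.adicCompletion K))
      (P : geomTorsion (W.baseChange K) ((p ^ (1 + u) : ℕ) : ℤ)), resGal (K := K) (v₀.adicCompletion K) g • P = P :=
    Walk.resGal_adicCompletion_smul_torsion_eq_self W hK hKol₀ h1u₀ v₀ hv₀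
  have hκ'v₀ : galoisCohomology.localization ((W.baseChange K).torsionGaloisModule ((p ^ (1 + u) : ℕ) : ℤ))
      (Sum.inr v₀ : Place K) 1 (d'.kolyvaginClass hp (1 + u)) ≠ 0 := by
    rw [← hrooty]
    exact fun h ↦ hy₀ ((localization_eq_zero_iff_torsionH1OfDvd W hdn (pow_ne_zero 1 hp.ne_zero)
      (pow_ne_zero _ hp.ne_zero) v₀ htriv₀ y).mpr h)
  have hκ''v₀ : galoisCohomology.localization ((W.baseChange K).torsionGaloisModule ((p ^ (1 + u) : ℕ) : ℤ))
      (Sum.inr v₀ : Place K) 1 (d''.kolyvaginClass hp (1 + u)) ≠ 0 := by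
    intro h
    have h' := h44dn
    rw [show (galoisCohomology.localization ((W.baseChange K).torsionGaloisModule ((p ^ (1 + u) : ℕ) : ℤ))
      (Sum.inr v₀ : Place K) 1 : galH1Torsion (W.baseChange K) ((p ^ (1 + u) : ℕ) : ℤ) →+ _)
      (d''.kolyvaginClass hp (1 + u)) = 0 from h, addOrderOf_zero] at h'
    exact hκ'v₀ (AddMonoid.addOrderOf_eq_one_iff.mp h')
  have hκ''0 : d''.kolyvaginClass hp (1 + u) ≠ 0 := fun h ↦ hκ''v₀ (by rw [h]; exact map_zero _)
  exact d''.not_pDiv_succ_of_kolyvaginClass_ne_zero hp u hκ''0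

end Prime

omit [W.IsElliptic] [W.IsGloballyMinimal] in
/-- **The conclusion of `not_dvd_of_swap_family` in tam3-p1's `PDiv` vocabulary** (appended, g15): `¬ (p^{u+1} ∣ P(d''))` is literally
`¬ d''.PDiv p (u + 1)` (`KolyvaginFamilyData.PDiv`, p592585) — recorded so that Zhang-currency consumers (`KolyvaginFamilyData.pDiv_of_swap_of_perLevel`)
and the Gross-currency end glue read the same statement. [cite: McCallumLMS1991, §5 (p. 303), `p^M | P_n`] -/
theorem not_pDiv_iff_not_exists_smul {ι : K →+* ℂ} {m : ℕ} (d : KolyvaginFamilyData W K ι m) (p M : ℕ) :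
    ¬ d.PDiv p M ↔ ¬ ∃ Q : (W.baseChange (ringClassField K ι m)).toAffine.Point, ((p ^ M : ℕ) : ℤ) • Q = d.derivedPoint :=
  Iff.rfl

end Summit.BirchSwinnertonDyer.Rank1Residual.JET.Swap

end
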